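import Summits.AnomalousDissipation.AnomalousDissipation.Theorems.SawtoothPulseCascadeK1LocalisedCascadeSymbolSocketV

/-!
# K1loc, line `Spectral` / SeqCone — helper: FIBRE-FACTOR DERIVATIVE BOUNDS, EXPLICIT IN `sup|sT′|` (S-B constants, (g3))

Helper file of the prover lane on the crux `K1LocalisedCascade` (stmt-AnomalousDissipation-19491), route
`SawtoothPulseCascade` (glue seat k1loc-p3).  At order `1` every fibre profile of the product symbols is locally the
three-factor model `1 − sT(p₁+q₁t)(1 − sT(p₂+q₂t)sT(p₃+q₃t))` (`…SymbolFibreDataH/V`), whose derivative is bounded by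
`C₁(|q₁|+|q₂|+|q₃|)` for ANY bound `C₁` of `|sT′|` (`abs_deriv_oneSubMulOneSubMul_le`); this file derives the first-derivative
bounds of the five fibre factors (H cone, envelope, H mid, V mid, V cone) with constants explicit in `C₁`
(`abs_deriv_coneFactorH_le`, `abs_deriv_envFactor_le`, `abs_deriv_midFactorH_le`, `abs_deriv_midFactorV_le`,
`abs_deriv_coneFactorV_le`).  No definitions; no statement about the stub.  [cite: Grafakos2014, Prop. 3.1.2 (5)] [problem: turb]
-/


-- `Summit.<Summit>.<Problem>`: single-conjunct summit, the duplicate namespace segment is deliberate.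
set_option linter.dupNamespace false

noncomputable section

namespace Summit.AnomalousDissipation.AnomalousDissipation.Theorems.SawtoothPulseCascade.K1Symbol

open Set Filter Topology Real
open scoped ContDiff
open Literature.Analysis.Calculus (differentiable_smoothTransition)
open Summit.AnomalousDissipation.AnomalousDissipation.Theorems.SawtoothPulseCascade.K1Cutoff
open Summit.AnomalousDissipation.AnomalousDissipation.Theorems.SawtoothPulseCascade.K1Slot

/-! ## The derivative of the three-factor model -/

/-- `d/dt sT(p + qt) = sT′(p + qt)·q`. [folklore] -/
theorem hasDerivAt_smoothTransition_affine (p q t : ℝ) :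
    HasDerivAt (fun t => smoothTransition (p + q * t)) (deriv smoothTransition (p + q * t) * q) t := by
  have hl : HasDerivAt (fun t => p + q * t) q t := by
    simpa using ((hasDerivAt_id t).const_mul q).const_add p
  exact (differentiable_smoothTransition _).hasDerivAt.comp t hl

/-- **`|d/dt (1 − sT(p₁+q₁t)(1 − sT(p₂+q₂t)sT(p₃+q₃t)))| ≤ C₁(|q₁| + |q₂| + |q₃|)`** for any bound `C₁` of `|sT′|`.
[cite: Grafakos2014, Prop. 3.1.2 (5)] -/
theorem abs_deriv_oneSubMulOneSubMul_le {C₁ : ℝ} (hC₁ : ∀ x, |deriv smoothTransition x| ≤ C₁)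
    (p₁ q₁ p₂ q₂ p₃ q₃ t : ℝ) :
    |deriv (fun t => 1 - smoothTransition (p₁ + q₁ * t) *
      (1 - smoothTransition (p₂ + q₂ * t) * smoothTransition (p₃ + q₃ * t))) t| ≤ C₁ * (|q₁| + |q₂| + |q₃|) := by
  have h1 := hasDerivAt_smoothTransition_affine p₁ q₁ t
  have h2 := hasDerivAt_smoothTransition_affine p₂ q₂ t
  have h3 := hasDerivAt_smoothTransition_affine p₃ q₃ t
  have h : HasDerivAt (fun t => 1 - smoothTransition (p₁ + q₁ * t) *
      (1 - smoothTransition (p₂ + q₂ * t) * smoothTransition (p₃ + q₃ * t)))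
      (0 - (deriv smoothTransition (p₁ + q₁ * t) * q₁ *
          (1 - smoothTransition (p₂ + q₂ * t) * smoothTransition (p₃ + q₃ * t)) +
        smoothTransition (p₁ + q₁ * t) * (0 - (deriv smoothTransition (p₂ + q₂ * t) * q₂ * smoothTransition (p₃ + q₃ * t) +
          smoothTransition (p₂ + q₂ * t) * (deriv smoothTransition (p₃ + q₃ * t) * q₃))))) t :=
    (hasDerivAt_const t 1).sub (h1.mul ((hasDerivAt_const t 1).sub (h2.mul h3)))
  rw [h.deriv]
  have hA0 := Real.smoothTransition.nonneg (p₁ + q₁ * t)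
  have hA1 := Real.smoothTransition.le_one (p₁ + q₁ * t)
  have hB0 := Real.smoothTransition.nonneg (p₂ + q₂ * t)
  have hB1 := Real.smoothTransition.le_one (p₂ + q₂ * t)
  have hC0 := Real.smoothTransition.nonneg (p₃ + q₃ * t)
  have hCle := Real.smoothTransition.le_one (p₃ + q₃ * t)
  have hBC1 : |1 - smoothTransition (p₂ + q₂ * t) * smoothTransition (p₃ + q₃ * t)| ≤ 1 := by
    rw [abs_of_nonneg (sub_nonneg.mpr (mul_le_one₀ hB1 hC0 hCle))]
    exact sub_le_self _ (mul_nonneg hB0 hC0)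
  have hd1 : |deriv smoothTransition (p₁ + q₁ * t) * q₁| ≤ C₁ * |q₁| := by
    rw [abs_mul]; exact mul_le_mul_of_nonneg_right (hC₁ _) (abs_nonneg _)
  have hd2 : |deriv smoothTransition (p₂ + q₂ * t) * q₂| ≤ C₁ * |q₂| := by
    rw [abs_mul]; exact mul_le_mul_of_nonneg_right (hC₁ _) (abs_nonneg _)
  have hd3 : |deriv smoothTransition (p₃ + q₃ * t) * q₃| ≤ C₁ * |q₃| := by
    rw [abs_mul]; exact mul_le_mul_of_nonneg_right (hC₁ _) (abs_nonneg _)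
  have hC₁0 : 0 ≤ C₁ := (abs_nonneg _).trans (hC₁ 0)
  rw [zero_sub, abs_neg, zero_sub]
  calc |deriv smoothTransition (p₁ + q₁ * t) * q₁ *
          (1 - smoothTransition (p₂ + q₂ * t) * smoothTransition (p₃ + q₃ * t)) +
        smoothTransition (p₁ + q₁ * t) * -(deriv smoothTransition (p₂ + q₂ * t) * q₂ * smoothTransition (p₃ + q₃ * t) +
          smoothTransition (p₂ + q₂ * t) * (deriv smoothTransition (p₃ + q₃ * t) * q₃))|
      ≤ |deriv smoothTransition (p₁ + q₁ * t) * q₁| *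
          |1 - smoothTransition (p₂ + q₂ * t) * smoothTransition (p₃ + q₃ * t)| +
        |smoothTransition (p₁ + q₁ * t)| * (|deriv smoothTransition (p₂ + q₂ * t) * q₂| * |smoothTransition (p₃ + q₃ * t)| +
          |smoothTransition (p₂ + q₂ * t)| * |deriv smoothTransition (p₃ + q₃ * t) * q₃|) := by
        refine (abs_add_le _ _).trans (add_le_add (le_of_eq (abs_mul _ _)) ?_)
        rw [abs_mul, abs_neg]
        refine mul_le_mul_of_nonneg_left ((abs_add_le _ _).trans (add_le_add (le_of_eq (abs_mul _ _))
          (le_of_eq (abs_mul _ _)))) (abs_nonneg _)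
    _ ≤ C₁ * |q₁| * 1 + 1 * (C₁ * |q₂| * 1 + 1 * (C₁ * |q₃|)) := by
        rw [abs_of_nonneg hA0, abs_of_nonneg hB0, abs_of_nonneg hC0]
        gcongr
    _ = C₁ * (|q₁| + |q₂| + |q₃|) := by ring

/-- The same bound for a function that is LOCALLY the three-factor model. [folklore] -/
theorem abs_deriv_le_of_locally_model {C₁ : ℝ} (hC₁ : ∀ x, |deriv smoothTransition x| ≤ C₁) {f : ℝ → ℝ}
    {p₁ q₁ p₂ q₂ p₃ q₃ x : ℝ}
    (h : f =ᶠ[𝓝 x] fun t => 1 - smoothTransition (p₁ + q₁ * t) *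
      (1 - smoothTransition (p₂ + q₂ * t) * smoothTransition (p₃ + q₃ * t))) :
    |deriv f x| ≤ C₁ * (|q₁| + |q₂| + |q₃|) := by
  rw [h.deriv_eq]; exact abs_deriv_oneSubMulOneSubMul_le hC₁ p₁ q₁ p₂ q₂ p₃ q₃ x

/-! ## The five fibre factors: derivative bounds explicit in `C₁` -/

/-- H cone factor: `|d/dt g^S(n,t)| ≤ C₁·|γ|/(ε_aL)` (`ε_a, a, L > 0`, any `n ∈ ℤ`). [cite: Grafakos2014, Prop. 3.1.2 (5)] -/
theorem abs_deriv_coneFactorH_le {C₁ : ℝ} (hC₁ : ∀ x, |deriv smoothTransition x| ≤ C₁) {γ ε εa a L : ℝ}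
    (hε : 0 < ε) (hεa : 0 < εa) (ha : 0 < a) (hL : 0 < L) (n : ℤ) (t : ℝ) :
    |deriv (fun t : ℝ => smoothTransition ((|(n : ℝ)| - L) / (ε * L)) *
      (1 - smoothTransition ((γ * |t| - a * |(n : ℝ)|) / (εa * L)))) t| ≤ C₁ * (|γ| / (εa * L)) := by
  have hC₁0 : 0 ≤ C₁ := (abs_nonneg _).trans (hC₁ 0)
  rcases eq_or_ne n 0 with hn | hn
  · subst hn
    have h0 : smoothTransition ((|((0 : ℤ) : ℝ)| - L) / (ε * L)) = 0 :=
      Real.smoothTransition.zero_of_nonpos (div_nonpos_of_nonpos_of_nonneg (by simp; exact hL.le) (by positivity))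
    simp only [h0, zero_mul, deriv_const']
    rw [abs_zero]; positivity
  · have hn' : (n : ℝ) ≠ 0 := by exact_mod_cast hn
    obtain ⟨p₂, q₂, hq₂, h⟩ := symS_fibreH_locally (γ := γ) (ε := ε) hεa hL ha hn' t
    have e : (fun t : ℝ => smoothTransition ((|(n : ℝ)| - L) / (ε * L)) *
        (1 - smoothTransition ((γ * |t| - a * |(n : ℝ)|) / (εa * L)))) = fun t => 1 - (fun t => 1 -
        smoothTransition ((|(n : ℝ)| - L) / (ε * L)) * (1 - smoothTransition ((γ * |t| - a * |(n : ℝ)|) / (εa * L)))) t := by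
      funext t; ring
    rw [e, deriv_const_sub, abs_neg]
    refine (abs_deriv_le_of_locally_model hC₁ h).trans ?_
    rw [abs_zero, zero_add, add_zero]
    exact mul_le_mul_of_nonneg_left hq₂ hC₁0

/-- Envelope factor (shifted): `|d/dt (1 − sT((|n|−R)/w))(1 − sT((|t−t₀|−R)/w))| ≤ C₁/w` (`R, w > 0`).
[cite: Grafakos2014, Prop. 3.1.2 (5)] -/
theorem abs_deriv_envFactor_le {C₁ : ℝ} (hC₁ : ∀ x, |deriv smoothTransition x| ≤ C₁) {R w : ℝ} (hR : 0 < R)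
    (hw : 0 < w) (n : ℤ) (t₀ t : ℝ) :
    |deriv (fun t : ℝ => (1 - smoothTransition ((|(n : ℝ)| - R) / w)) * (1 - smoothTransition ((|t - t₀| - R) / w))) t|
      ≤ C₁ * (1 / w) := by
  set E : ℝ → ℝ := fun s => (1 - smoothTransition ((|(n : ℝ)| - R) / w)) * (1 - smoothTransition ((|s| - R) / w))
    with hE
  have eshift : (fun t : ℝ => (1 - smoothTransition ((|(n : ℝ)| - R) / w)) * (1 - smoothTransition ((|t - t₀| - R) / w)))
      = fun t => E (t - t₀) := by funext t; simp only [hE]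
  rw [eshift, deriv_comp_sub_const]
  obtain ⟨p₁, p₂, q₂, hq₂, h⟩ := symEnv_fibre_locally hR hw (n : ℝ) (t - t₀)
  have e : E = fun s => 1 - (fun s => 1 - (1 - smoothTransition ((|(n : ℝ)| - R) / w)) *
      (1 - smoothTransition ((|s| - R) / w))) s := by funext s; simp only [hE]; ring
  rw [e, deriv_const_sub, abs_neg]
  refine (abs_deriv_le_of_locally_model hC₁ h).trans ?_
  rw [abs_zero, zero_add, add_zero]
  exact mul_le_mul_of_nonneg_left hq₂ ((abs_nonneg _).trans (hC₁ 0))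

/-- H mid factor (shifted): `|d/dt g^M(n, t − t₀)| ≤ C₁·2|γ|/(ε_aL₀)` (`ε, ε_a, a₂, L₀ > 0`, any `n ∈ ℤ`).
[cite: Grafakos2014, Prop. 3.1.2 (5)] -/
theorem abs_deriv_midFactorH_le {C₁ : ℝ} (hC₁ : ∀ x, |deriv smoothTransition x| ≤ C₁) {γ ε εa a₂ L₀ : ℝ}
    (hε : 0 < ε) (hεa : 0 < εa) (ha₂ : 0 < a₂) (hL₀ : 0 < L₀) (n : ℤ) (t₀ t : ℝ) :
    |deriv (fun t : ℝ => smoothTransition ((|(n : ℝ)| - L₀) / (ε * L₀)) *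
        (1 - smoothTransition ((γ * |t - t₀ + γ * n| - a₂ * |(n : ℝ)|) / (εa * L₀)) *
          smoothTransition ((γ * |t - t₀ - γ * n| - a₂ * |(n : ℝ)|) / (εa * L₀)))) t| ≤ C₁ * (2 * |γ| / (εa * L₀)) := by
  have hC₁0 : 0 ≤ C₁ := (abs_nonneg _).trans (hC₁ 0)
  rcases eq_or_ne n 0 with hn | hn
  · subst hn
    have h0 : smoothTransition ((|((0 : ℤ) : ℝ)| - L₀) / (ε * L₀)) = 0 :=
      Real.smoothTransition.zero_of_nonpos (div_nonpos_of_nonpos_of_nonneg (by simp; exact hL₀.le) (by positivity))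
    simp only [h0, zero_mul, deriv_const']
    rw [abs_zero]; positivity
  · have hn' : (n : ℝ) ≠ 0 := by exact_mod_cast hn
    obtain ⟨p₂, q₂, p₃, q₃, hq₂, hq₃, h⟩ := symM_fibreH_locally (γ := γ) (ε := ε) hεa hL₀ ha₂ hn' t₀ t
    have e : (fun t : ℝ => smoothTransition ((|(n : ℝ)| - L₀) / (ε * L₀)) *
        (1 - smoothTransition ((γ * |t - t₀ + γ * n| - a₂ * |(n : ℝ)|) / (εa * L₀)) *
          smoothTransition ((γ * |t - t₀ - γ * n| - a₂ * |(n : ℝ)|) / (εa * L₀)))) = fun t => 1 - (fun t => 1 -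
        smoothTransition ((|(n : ℝ)| - L₀) / (ε * L₀)) *
        (1 - smoothTransition ((γ * |t - t₀ + γ * n| - a₂ * |(n : ℝ)|) / (εa * L₀)) *
          smoothTransition ((γ * |t - t₀ - γ * n| - a₂ * |(n : ℝ)|) / (εa * L₀)))) t := by
      funext t; ring
    rw [e, deriv_const_sub, abs_neg]
    refine (abs_deriv_le_of_locally_model hC₁ h).trans ?_
    rw [abs_zero, zero_add]
    calc C₁ * (|q₂| + |q₃|) ≤ C₁ * (|γ| / (εa * L₀) + |γ| / (εa * L₀)) := by gcongr
      _ = C₁ * (2 * |γ| / (εa * L₀)) := by ring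

/-- V mid factor: `|d/dt g^M(t, n′)| ≤ C₁(1/(εL₀) + 2(γ²+a₂)/(ε_aL₀))` (`ε, ε_a, a₂, L₀ > 0`).
[cite: Grafakos2014, Prop. 3.1.2 (5)] -/
theorem abs_deriv_midFactorV_le {C₁ : ℝ} (hC₁ : ∀ x, |deriv smoothTransition x| ≤ C₁) {γ ε εa a₂ L₀ : ℝ}
    (hε : 0 < ε) (hεa : 0 < εa) (ha₂ : 0 < a₂) (hL₀ : 0 < L₀) (n' : ℤ) (t : ℝ) :
    |deriv (fun t : ℝ => smoothTransition ((|t| - L₀) / (ε * L₀)) *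
        (1 - smoothTransition ((γ * |(n' : ℝ) + γ * t| - a₂ * |t|) / (εa * L₀)) *
          smoothTransition ((γ * |(n' : ℝ) - γ * t| - a₂ * |t|) / (εa * L₀)))) t| ≤
      C₁ * (1 / (ε * L₀) + 2 * (γ ^ 2 + a₂) / (εa * L₀)) := by
  have hC₁0 : 0 ≤ C₁ := (abs_nonneg _).trans (hC₁ 0)
  have e : (fun t : ℝ => smoothTransition ((|t| - L₀) / (ε * L₀)) *
      (1 - smoothTransition ((γ * |(n' : ℝ) + γ * t| - a₂ * |t|) / (εa * L₀)) *
        smoothTransition ((γ * |(n' : ℝ) - γ * t| - a₂ * |t|) / (εa * L₀)))) = fun t => 1 - (fun t => 1 -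
      smoothTransition ((|t| - L₀) / (ε * L₀)) *
      (1 - smoothTransition ((γ * |(n' : ℝ) + γ * t| - a₂ * |t|) / (εa * L₀)) *
        smoothTransition ((γ * |(n' : ℝ) - γ * t| - a₂ * |t|) / (εa * L₀)))) t := by
    funext t; ring
  rw [e, deriv_const_sub, abs_neg]
  rcases symM_fibreV_locally (γ := γ) hε hεa ha₂ hL₀ (n' : ℝ) t with h | ⟨p₁, q₁, p₂, q₂, p₃, q₃, hq₁, hq₂, hq₃, h⟩
  · rw [h.deriv_eq, deriv_const, abs_zero]; positivity
  · refine (abs_deriv_le_of_locally_model hC₁ h).trans ?_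
    calc C₁ * (|q₁| + |q₂| + |q₃|) ≤ C₁ * (1 / (ε * L₀) + (γ ^ 2 + a₂) / (εa * L₀) + (γ ^ 2 + a₂) / (εa * L₀)) := by gcongr
      _ = C₁ * (1 / (ε * L₀) + 2 * (γ ^ 2 + a₂) / (εa * L₀)) := by ring

/-- V cone factor (shifted): `|d/dt g^S(t − t₀, n′)| ≤ C₁(1/(εL) + a/(ε_aL))` (`ε, ε_a, a, L > 0`).
[cite: Grafakos2014, Prop. 3.1.2 (5)] -/
theorem abs_deriv_coneFactorV_le {C₁ : ℝ} (hC₁ : ∀ x, |deriv smoothTransition x| ≤ C₁) {γ ε εa a L : ℝ}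
    (hε : 0 < ε) (hεa : 0 < εa) (ha : 0 < a) (hL : 0 < L) (n' : ℤ) (t₀ t : ℝ) :
    |deriv (fun t : ℝ => smoothTransition ((|t - t₀| - L) / (ε * L)) *
      (1 - smoothTransition ((γ * |(n' : ℝ)| - a * |t - t₀|) / (εa * L)))) t| ≤ C₁ * (1 / (ε * L) + a / (εa * L)) := by
  have hC₁0 : 0 ≤ C₁ := (abs_nonneg _).trans (hC₁ 0)
  set G : ℝ → ℝ := fun s => smoothTransition ((|s| - L) / (ε * L)) *
    (1 - smoothTransition ((γ * |(n' : ℝ)| - a * |s|) / (εa * L))) with hG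
  have eshift : (fun t : ℝ => smoothTransition ((|t - t₀| - L) / (ε * L)) *
      (1 - smoothTransition ((γ * |(n' : ℝ)| - a * |t - t₀|) / (εa * L)))) = fun t => G (t - t₀) := by
    funext t; simp only [hG]
  rw [eshift, deriv_comp_sub_const]
  have e : G = fun s => 1 - (fun s => 1 - smoothTransition ((|s| - L) / (ε * L)) *
      (1 - smoothTransition ((γ * |(n' : ℝ)| - a * |s|) / (εa * L)))) s := by funext s; simp only [hG]; ring
  rw [e, deriv_const_sub, abs_neg]
  rcases symS_fibreV_locally (γ := γ) (a := a) hε hεa hL (n' : ℝ) (t - t₀) with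
    h | ⟨p₁, q₁, p₂, q₂, p₃, q₃, hq₁, hq₂, hq₃, h⟩
  · rw [h.deriv_eq, deriv_const, abs_zero]; positivity
  · refine (abs_deriv_le_of_locally_model hC₁ h).trans ?_
    rw [hq₃, abs_zero, add_zero]
    rw [abs_of_pos ha] at hq₂
    gcongr

end Summit.AnomalousDissipation.AnomalousDissipation.Theorems.SawtoothPulseCascade.K1Symbol
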